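import Summits.Ventures.LatticeQCDFlow.Scoring.ChainWindowGammaMethod
import Summits.Ventures.LatticeQCDFlow.Scoring.GammaStatSeries
import Summits.Ventures.LatticeQCDFlow.Scoring.ChainLagProductACov
import Summits.Ventures.LatticeQCDFlow.Scoring.ChainWindowFunctionalSLLN
import Summits.Ventures.LatticeQCDFlow.Scoring.MadrasSokalDataWindowCLT

/-!
# A CONSISTENT, DATA-DRIVEN ESTIMATOR OF THE ASYMPTOTIC VARIANCE `σ²_ℓ` OF `τ̂_W` ON MARKOV-CHAIN DATA:
# the Γ-method applied to the lag-product series, POLARISED into a matrix estimator of Bartlett's `Σ`,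
# contracted with the ESTIMATED gradient — `σ̂²_N → σ²_ℓ = ℓᵀ Σ ℓ` in probability from EVERY initial law

HONEST FRAMING: exact (Metropolis-corrected) sampling algorithms for lattice gauge theory;
figures of merit are autocorrelation/cost numbers at stated couplings and volumes; no
continuum-physics claim.

Venture `LatticeQCDFlow` (cell pub-lqcd), sub-topic `Scoring`; FANOUT row 16 (`su2-base`), GEN-10.
NEW WORK of the cell, not a published result; no definition is introduced (the real-series statistics
`gammaStat` — scorer A's windowed variance statistic `Γ̂^u_N(0) · 2 τ̂^u_{N,K}` of ONE series, the object
of row 13's `NCMCGeneralSpaceGammaMethodConsistency` — and `gammaCross` — its POLARISATION, a cross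
long-run covariance statistic of TWO series — are GEN-10's `Scoring/GammaStatSeries`); nothing is cited
as a fact (windowed estimators of
the covariance matrix of sample autocovariances — Bartlett 1946, Priestley 1981 §5.3/§6.2; Geyer 1992
§3 — NAMED ONLY).  GEN-9 left the studentisation of its `τ̂_W` CLT on chain data
(`Scoring/ChainTauIntWindowCLT`: asymptotic variance `σ²_ℓ = ℓᵀ Σ ℓ`, `Σ = chainLagACov κ π f̄ W`,
`ℓ = tauHatGrad W (C(t))_t`) at a FIXED truncation (`Scoring/ChainLagProductACovEstimator`: `→ ℓᵀ Σ_K ℓ`,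
'NOT CLAIMED: a data-driven truncation K_N → ∞').  THIS FILE: with GEN-10's Γ-method for window
functionals (`Scoring/ChainWindowGammaMethod`: for every bounded window functional `φ`, scorer A's
statistic of the series `φ(Y_i)` with truncations `K_N → ∞`, `K_N³/N → 0` converges in probability
to `windowLRVar κ π W φ`), applied to the lag-product combinations `Σ_t a_t f̄(X_i) f̄(X_{i+t})`
(`lagProdComb`, whose long-run variance is the quadratic form `aᵀ Σ a` — GEN-9's
`quadForm_chainLagACov_of_nHit`) at the three vectors `e_s`, `e_t`, `e_s + e_t`, POLARISATION gives a
matrix statistic `Σ̂_N(s,t) → Σ(s,t)` in probability, and contracting with the estimated gradient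
`ℓ̂_N = tauHatGrad W (Γ̂_N(t))_t → ℓ` gives `σ̂²_N = Σ_{s,t} ℓ̂_s ℓ̂_t Σ̂_N(s,t) → σ²_ℓ` in probability,
from EVERY initial law — the input of the studentised `τ̂_W` CLT on chain data (next file).

## Content (`κ` Markov, `π` invariant, `(nHit κ m)(z, ·) ≥ ε ν` for all `z`, `ε ≠ 0`, `0 < m`;
## `|f| ≤ C` measurable, `f̄ = f − ∫ f dπ`, `C(t) = autocov κ π f̄ t`, `Σ = chainLagACov κ π f̄ W`;
## `p^s_i = f̄(X_i) f̄(X_{i+s})` the lag-`s` product series; `K_N → ∞`, `K_N³/N → 0`; `μ₀` ANY law)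

* `tendstoInMeasure_mul_lim`, `_sub_lim`, `_div_const_lim`, `_finset_sum_lim` — in-measure algebra.
* **`chain_lagProdComb_gammaStat_tendstoInMeasure_of_nHit`** — for every `a`:
  `gammaStat (Σ_t a_t p^t) N K_N → windowLRVar κ π W (lagProdComb f̄ W a) = aᵀ Σ a` in `P_{μ₀}`-measure.
* `quadForm_single`, `quadForm_single_add_single`, **`chainLagACov_eq_polar`** — POLARISATION:
  `Σ(s,t) = ½ (Q(e_s + e_t) − Q(e_s) − Q(e_t))`, `Q(a) = windowLRVar κ π W (lagProdComb f̄ W a)`.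
* **`chain_gammaCross_tendstoInMeasure_of_nHit`** — THE MATRIX ESTIMATOR:
  `gammaCross p^s p^t N K_N → Σ(s,t)` in `P_{μ₀}`-measure, every `s, t ≤ W`.
* `chain_tauHatGrad_tendstoInMeasure_of_nHit` — `ℓ̂_{N,i} → ℓ_i` in measure (`C(0) ≠ 0`).
* **`chain_tauIntVarHat_tendstoInMeasure_of_nHit`** — THE PLUG-IN VARIANCE:
  `σ̂²_N = Σ_s Σ_t ℓ̂_{N,s} ℓ̂_{N,t} gammaCross p^s p^t N K_N → Σ_s Σ_t ℓ_s ℓ_t Σ(s,t) = σ²_ℓ` in measure.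

NOT CLAIMED: sample-mean centring INSIDE the lag products (`f̄` uses the true mean `∫ f dπ`; for an
observable whose mean is known by symmetry — the topological charge — the statistic is computable as
stated; the general case needs the `O_P(K_N/√N)` perturbation bound, not typed); the automatic window;
`σ²_ℓ > 0`; almost-sure convergence; rates; any number about row 16's chains.
-/

noncomputable section

open MeasureTheory ProbabilityTheory Filter Finset Preorder WithLp
open scoped ENNReal NNReal Topology RealInnerProductSpace
open Summit.Ventures.LatticeQCDFlow.Exactness Summit.Ventures.LatticeQCDFlow.Exactness.GeneralNCMC

namespace Summit.Ventures.LatticeQCDFlow.Scoring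

/-! ## Small algebra of convergence in measure -/

section InMeasure

variable {Ω : Type*} [MeasurableSpace Ω] {P : Measure Ω}

/-- Products of in-probability convergent real sequences converge in probability to the product. -/
theorem tendstoInMeasure_mul_lim {U V : ℕ → Ω → ℝ} {u v : ℝ}
    (hU : TendstoInMeasure P U atTop fun _ => u) (hV : TendstoInMeasure P V atTop fun _ => v) :
    TendstoInMeasure P (fun N ω => U N ω * V N ω) atTop fun _ => u * v :=
  CardConsistency.tendstoInMeasure_comp_continuousAt_normed (CardConsistency.tendstoInMeasure_prodMk hU hV)
    (φ := fun q : ℝ × ℝ => q.1 * q.2) (by fun_prop : Continuous fun q : ℝ × ℝ => q.1 * q.2).continuousAt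

/-- Differences of in-probability convergent real sequences converge in probability to the difference. -/
theorem tendstoInMeasure_sub_lim {U V : ℕ → Ω → ℝ} {u v : ℝ}
    (hU : TendstoInMeasure P U atTop fun _ => u) (hV : TendstoInMeasure P V atTop fun _ => v) :
    TendstoInMeasure P (fun N ω => U N ω - V N ω) atTop fun _ => u - v :=
  CardConsistency.tendstoInMeasure_comp_continuousAt_normed (CardConsistency.tendstoInMeasure_prodMk hU hV)
    (φ := fun q : ℝ × ℝ => q.1 - q.2) (by fun_prop : Continuous fun q : ℝ × ℝ => q.1 - q.2).continuousAt

/-- Division by a constant preserves convergence in probability. -/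
theorem tendstoInMeasure_div_const_lim {U : ℕ → Ω → ℝ} {u : ℝ}
    (hU : TendstoInMeasure P U atTop fun _ => u) (c : ℝ) :
    TendstoInMeasure P (fun N ω => U N ω / c) atTop fun _ => u / c :=
  CardConsistency.tendstoInMeasure_comp_continuousAt_normed hU
    (φ := fun q : ℝ => q / c) (by fun_prop : Continuous fun q : ℝ => q / c).continuousAt

/-- Finite sums of in-probability convergent real sequences converge in probability to the sum. -/
theorem tendstoInMeasure_finset_sum_lim [IsProbabilityMeasure P] {ι : Type*} (s : Finset ι)
    {U : ι → ℕ → Ω → ℝ} {u : ι → ℝ}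
    (h : ∀ i ∈ s, TendstoInMeasure P (U i) atTop fun _ => u i) :
    TendstoInMeasure P (fun N ω => ∑ i ∈ s, U i N ω) atTop fun _ => ∑ i ∈ s, u i := by
  classical
  induction s using Finset.induction_on with
  | empty => simpa using tendstoInMeasure_const_real (P := P) 0
  | @insert j s hj ih =>
    have hj' := h j (Finset.mem_insert_self j s)
    have hs := ih fun i hi => h i (Finset.mem_insert_of_mem hi)
    simpa only [Finset.sum_insert hj] using tendstoInMeasure_add_lim hj' hs

end InMeasure

/-! ## Polarisation algebra -/

section Polar

variable {W : ℕ}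

/-- `Σ_{s'} Σ_{t'} (e_a)_{s'} (e_b)_{t'} B(s',t') = B(a,b)`. -/
theorem sum_sum_single_mul_single (B : Fin (W + 1) → Fin (W + 1) → ℝ) (a b : Fin (W + 1)) :
    ∑ s' : Fin (W + 1), ∑ t' : Fin (W + 1),
      EuclideanSpace.single a (1 : ℝ) s' * EuclideanSpace.single b (1 : ℝ) t' * B s' t' = B a b := by
  rw [Finset.sum_eq_single a, Finset.sum_eq_single b]
  · simp only [EuclideanSpace.single, PiLp.single_apply, if_true, one_mul]
  · intro t' _ ht'
    simp only [EuclideanSpace.single, PiLp.single_apply, if_neg ht', mul_zero, zero_mul]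
  · intro h; exact absurd (Finset.mem_univ b) h
  · intro s' _ hs'
    exact Finset.sum_eq_zero fun t' _ => by
      simp only [EuclideanSpace.single, PiLp.single_apply, if_neg hs', zero_mul]
  · intro h; exact absurd (Finset.mem_univ a) h

/-- `Σ_{s'} Σ_{t'} (e_s)_{s'} (e_s)_{t'} B(s',t') = B(s,s)`. -/
theorem quadForm_single (B : Fin (W + 1) → Fin (W + 1) → ℝ) (s : Fin (W + 1)) :
    ∑ s' : Fin (W + 1), ∑ t' : Fin (W + 1),
      EuclideanSpace.single s (1 : ℝ) s' * EuclideanSpace.single s (1 : ℝ) t' * B s' t' = B s s :=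
  sum_sum_single_mul_single B s s

/-- `Σ_{s'} Σ_{t'} (e_s + e_t)_{s'} (e_s + e_t)_{t'} B(s',t') = B(s,s) + B(s,t) + B(t,s) + B(t,t)`. -/
theorem quadForm_single_add_single (B : Fin (W + 1) → Fin (W + 1) → ℝ) (s t : Fin (W + 1)) :
    ∑ s' : Fin (W + 1), ∑ t' : Fin (W + 1),
      (EuclideanSpace.single s (1 : ℝ) + EuclideanSpace.single t (1 : ℝ)) s'
        * (EuclideanSpace.single s (1 : ℝ) + EuclideanSpace.single t (1 : ℝ)) t' * B s' t'
      = B s s + B s t + B t s + B t t := by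
  simp only [PiLp.add_apply, add_mul, mul_add, Finset.sum_add_distrib, sum_sum_single_mul_single]
  ring

end Polar

/-! ## The lag-product series at the coordinate vectors -/

section LagSeries

variable {S : Type*} (g : S → ℝ) (W : ℕ)

/-- `lagProdComb g W e_s` read on the `i`-th window is the lag-`s` product `g(x_i) g(x_{i+s})`. -/
theorem lagProdComb_single_windowPath (s : Fin (W + 1)) (x : ℕ → S) (i : ℕ) :
    lagProdComb g W (EuclideanSpace.single s (1 : ℝ)) (windowPath W x i) = g (x i) * g (x (i + s)) := by
  rw [lagProdComb_windowPath]
  simp only [EuclideanSpace.single, PiLp.single_apply, ite_mul, one_mul, zero_mul,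
    Finset.sum_ite_eq', Finset.mem_univ, if_true]

/-- `lagProdComb g W (e_s + e_t)` read on the `i`-th window is `g(x_i) g(x_{i+s}) + g(x_i) g(x_{i+t})`. -/
theorem lagProdComb_single_add_single_windowPath (s t : Fin (W + 1)) (x : ℕ → S) (i : ℕ) :
    lagProdComb g W (EuclideanSpace.single s (1 : ℝ) + EuclideanSpace.single t (1 : ℝ)) (windowPath W x i)
      = g (x i) * g (x (i + s)) + g (x i) * g (x (i + t)) := by
  rw [lagProdComb_windowPath]
  simp only [EuclideanSpace.single, PiLp.add_apply, PiLp.single_apply, add_mul, ite_mul, one_mul,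
    zero_mul, Finset.sum_add_distrib, Finset.sum_ite_eq', Finset.mem_univ, if_true]

end LagSeries

/-! ## Along the chain -/

section Chain

variable {S : Type*} [MeasurableSpace S]
variable (κ : Kernel S S) [IsMarkovKernel κ] (W : ℕ) {π : Measure S} [IsProbabilityMeasure π]
  {ν : Measure S} [IsProbabilityMeasure ν] {ε : ℝ≥0∞} {m : ℕ}

/-- **The Γ-method statistic of a lag-product combination converges to its long-run variance**: for
every `a`, scorer A's statistic of the series `Σ_t a_t f̄(X_i) f̄(X_{i+t})` with truncations
`K_N → ∞`, `K_N³/N → 0` converges in `P_{μ₀}`-measure to `windowLRVar κ π W (lagProdComb f̄ W a)`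
(`= aᵀ Σ a`), from EVERY initial law. -/
theorem chain_lagProdComb_gammaStat_tendstoInMeasure_of_nHit (hπ : Kernel.Invariant κ π) (hε : ε ≠ 0)
    (hmin : ∀ z, ε • ν ≤ nHit κ m z) (hm : 0 < m)
    {f : S → ℝ} (hf : Measurable f) {C : ℝ} (hC : ∀ z, |f z| ≤ C)
    {K : ℕ → ℕ} (hK : Tendsto K atTop atTop) (hK3 : Tendsto (fun N => (K N : ℝ) ^ 3 / N) atTop (𝓝 0))
    (μ₀ : Measure S) [IsProbabilityMeasure μ₀] (a : EuclideanSpace ℝ (Fin (W + 1))) :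
    TendstoInMeasure (Kernel.trajMeasure (X := fun _ : ℕ => S) μ₀
        (fun n : ℕ => κ.comap (fun hh : (i : ↥(Finset.Iic n)) → S => hh ⟨n, Finset.mem_Iic.2 le_rfl⟩)
          (measurable_pi_apply _)))
      (fun (N : ℕ) (x : ℕ → S) =>
        gammaStat (fun i => lagProdComb (fun z => f z - ∫ z', f z' ∂π) W a (windowPath W x i)) N (K N))
      atTop (fun _ => windowLRVar κ π W (lagProdComb (fun z => f z - ∫ z', f z' ∂π) W a)) := by
  obtain ⟨hgm, hgC, -⟩ := centred_observable_bounds π hf hC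
  exact chain_windowGammaWindow_tendstoInMeasure_of_nHit κ W hπ hε hmin hm
    (measurable_lagProdComb hgm W a) (abs_lagProdComb_le hgC W a) hK hK3 μ₀

/-- **POLARISATION**: `Σ(s,t) = ½ (Q(e_s + e_t) − Q(e_s) − Q(e_t))` with
`Q(a) = windowLRVar κ π W (lagProdComb g W a)` (the quadratic form of `Σ`, GEN-9) and `Σ` symmetric. -/
theorem chainLagACov_eq_polar (hπ : Kernel.Invariant κ π) (hε : ε ≠ 0)
    (hmin : ∀ z, ε • ν ≤ nHit κ m z) (hm : 0 < m) {g : S → ℝ} (hg : Measurable g) {C : ℝ}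
    (hC : ∀ z, |g z| ≤ C) (s t : Fin (W + 1)) :
    chainLagACov κ π g W s t
      = (windowLRVar κ π W (lagProdComb g W (EuclideanSpace.single s (1 : ℝ) + EuclideanSpace.single t (1 : ℝ)))
          - windowLRVar κ π W (lagProdComb g W (EuclideanSpace.single s (1 : ℝ)))
          - windowLRVar κ π W (lagProdComb g W (EuclideanSpace.single t (1 : ℝ)))) / 2 := by
  rw [← quadForm_chainLagACov_of_nHit κ W hπ hε hmin hm hg hC,
    ← quadForm_chainLagACov_of_nHit κ W hπ hε hmin hm hg hC,
    ← quadForm_chainLagACov_of_nHit κ W hπ hε hmin hm hg hC,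
    quadForm_single_add_single, quadForm_single, quadForm_single, chainLagACov_comm κ π g W t s]
  ring

/-- **THE POLARISED MATRIX ESTIMATOR IS CONSISTENT FOR BARTLETT'S `Σ` ON CHAIN DATA, FROM EVERY
INITIAL LAW**: with `p^s_i = f̄(X_i) f̄(X_{i+s})` and truncations `K_N → ∞`, `K_N³/N → 0`,
`gammaCross p^s p^t N K_N → Σ(s,t) = chainLagACov κ π f̄ W s t` in `P_{μ₀}`-measure, all `s, t ≤ W`. -/
theorem chain_gammaCross_tendstoInMeasure_of_nHit (hπ : Kernel.Invariant κ π) (hε : ε ≠ 0)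
    (hmin : ∀ z, ε • ν ≤ nHit κ m z) (hm : 0 < m)
    {f : S → ℝ} (hf : Measurable f) {C : ℝ} (hC : ∀ z, |f z| ≤ C)
    {K : ℕ → ℕ} (hK : Tendsto K atTop atTop) (hK3 : Tendsto (fun N => (K N : ℝ) ^ 3 / N) atTop (𝓝 0))
    (μ₀ : Measure S) [IsProbabilityMeasure μ₀] (s t : Fin (W + 1)) :
    TendstoInMeasure (Kernel.trajMeasure (X := fun _ : ℕ => S) μ₀
        (fun n : ℕ => κ.comap (fun hh : (i : ↥(Finset.Iic n)) → S => hh ⟨n, Finset.mem_Iic.2 le_rfl⟩)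
          (measurable_pi_apply _)))
      (fun (N : ℕ) (x : ℕ → S) =>
        gammaCross (fun i => (f (x i) - ∫ z', f z' ∂π) * (f (x (i + s)) - ∫ z', f z' ∂π))
          (fun i => (f (x i) - ∫ z', f z' ∂π) * (f (x (i + t)) - ∫ z', f z' ∂π)) N (K N))
      atTop (fun _ => chainLagACov κ π (fun z => f z - ∫ z', f z' ∂π) W s t) := by
  obtain ⟨hgm, hgC, -⟩ := centred_observable_bounds π hf hC
  have hst := chain_lagProdComb_gammaStat_tendstoInMeasure_of_nHit κ W hπ hε hmin hm hf hC hK hK3 μ₀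
    (EuclideanSpace.single s (1 : ℝ) + EuclideanSpace.single t (1 : ℝ))
  have hs := chain_lagProdComb_gammaStat_tendstoInMeasure_of_nHit κ W hπ hε hmin hm hf hC hK hK3 μ₀
    (EuclideanSpace.single s (1 : ℝ))
  have ht := chain_lagProdComb_gammaStat_tendstoInMeasure_of_nHit κ W hπ hε hmin hm hf hC hK hK3 μ₀
    (EuclideanSpace.single t (1 : ℝ))
  simp only [lagProdComb_single_add_single_windowPath, lagProdComb_single_windowPath] at hst hs ht
  have h := tendstoInMeasure_div_const_lim (tendstoInMeasure_sub_lim (tendstoInMeasure_sub_lim hst hs) ht) 2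
  rw [← chainLagACov_eq_polar κ W hπ hε hmin hm hgm hgC s t] at h
  exact h

/-- The coordinates of GEN-7's gradient `tauHatGrad`. -/
theorem tauHatGrad_coord (c : EuclideanSpace ℝ (Fin (W + 1))) (i : Fin (W + 1)) :
    tauHatGrad W c i = if i = 0 then -(∑ t : Fin W, c t.succ) / c 0 ^ 2 else 1 / c 0 := rfl

/-- Measurability of the known-mean empirical autocovariances of `f̄ ∘ X` along a path. -/
theorem measurable_chain_acovHat {f : S → ℝ} (hf : Measurable f) (c : ℝ) (N t : ℕ) :
    Measurable (acovHat (fun (i : ℕ) (x : ℕ → S) => f (x i) - c) N t) := by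
  have hXm : ∀ i : ℕ, Measurable fun x : ℕ → S => f (x i) - c := fun i =>
    (hf.comp (measurable_pi_apply i)).sub measurable_const
  unfold acovHat
  exact (Finset.measurable_sum _ fun i _ => (hXm i).mul (hXm (i + t))).div_const _

/-- Measurability of the coordinates of the estimated gradient `ℓ̂_N = tauHatGrad W (Γ̂_N(t))_t`. -/
theorem measurable_chain_tauHatGrad {f : S → ℝ} (hf : Measurable f) (c : ℝ) (N : ℕ) (i : Fin (W + 1)) :
    Measurable fun x : ℕ → S =>
      tauHatGrad W (toLp 2 fun u : Fin (W + 1) => acovHat (fun (i : ℕ) (x : ℕ → S) => f (x i) - c) N u x) i := by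
  simp only [tauHatGrad_coord]
  by_cases hi : i = 0
  · simp only [hi, if_true]
    exact (Finset.measurable_sum _ fun t _ => measurable_chain_acovHat hf c N _).neg.div
      ((measurable_chain_acovHat hf c N 0).pow_const 2)
  · simp only [hi, if_false]
    exact measurable_const.div (measurable_chain_acovHat hf c N 0)

/-- **The estimated gradient converges in probability**: with `Γ̂_N(t) = acovHat (f̄ ∘ X) N t` and
`C(0) ≠ 0`, every coordinate of `ℓ̂_N = tauHatGrad W (Γ̂_N(t))_t` converges in `P_{μ₀}`-measure to the
coordinate of `ℓ = tauHatGrad W (C(t))_t` (from GEN-9's almost-sure consistency of `Γ̂_N`). -/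
theorem chain_tauHatGrad_tendstoInMeasure_of_nHit (hπ : Kernel.Invariant κ π) (hε : ε ≠ 0)
    (hmin : ∀ z, ε • ν ≤ nHit κ m z) {f : S → ℝ} (hf : Measurable f) {C : ℝ} (hC : ∀ z, |f z| ≤ C)
    (hσ : autocov κ π (fun z => f z - ∫ z', f z' ∂π) 0 ≠ 0)
    (μ₀ : Measure S) [IsProbabilityMeasure μ₀] (i : Fin (W + 1)) :
    TendstoInMeasure (Kernel.trajMeasure (X := fun _ : ℕ => S) μ₀
        (fun n : ℕ => κ.comap (fun hh : (i : ↥(Finset.Iic n)) → S => hh ⟨n, Finset.mem_Iic.2 le_rfl⟩)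
          (measurable_pi_apply _)))
      (fun (N : ℕ) (x : ℕ → S) => tauHatGrad W (toLp 2 fun u : Fin (W + 1) =>
        acovHat (fun (i : ℕ) (x : ℕ → S) => f (x i) - ∫ z', f z' ∂π) N u x) i)
      atTop (fun _ => tauHatGrad W (toLp 2 fun u : Fin (W + 1) =>
        autocov κ π (fun z => f z - ∫ z', f z' ∂π) u) i) := by
  have hGam := ae_all_iff.2 fun u : ℕ => ae_tendsto_chain_acovHat_of_nHit κ hπ hε hmin hf hC μ₀ u
  refine tendstoInMeasure_of_tendsto_ae
    (fun N => (measurable_chain_tauHatGrad W hf _ N i).aestronglyMeasurable) ?_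
  filter_upwards [hGam] with x hGx
  simp only [tauHatGrad_coord]
  by_cases hi : i = 0
  · simp only [hi, if_true]
    exact ((tendsto_finsetSum _ fun t _ => hGx _).neg).div ((hGx 0).pow 2) (pow_ne_zero 2 hσ)
  · simp only [hi, if_false]
    exact tendsto_const_nhds.div (hGx 0) hσ

/-- **THE PLUG-IN VARIANCE OF `τ̂_W` IS CONSISTENT ON CHAIN DATA, FROM EVERY INITIAL LAW.**  With
`p^s_i = f̄(X_i) f̄(X_{i+s})`, `ℓ̂_N = tauHatGrad W (Γ̂_N(t))_t` (`Γ̂_N = acovHat (f̄ ∘ X) N`),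
`ℓ = tauHatGrad W (C(t))_t`, `C(0) ≠ 0`, and truncations `K_N → ∞`, `K_N³/N → 0`:
`σ̂²_N = Σ_s Σ_t ℓ̂_{N,s} ℓ̂_{N,t} gammaCross p^s p^t N K_N → σ²_ℓ = Σ_s Σ_t ℓ_s ℓ_t Σ(s,t)` in
`P_{μ₀}`-measure — the asymptotic variance of GEN-9's `τ̂_W` CLT
(`hasLaw_chain_tauIntWindow_limit_quadForm`). -/
theorem chain_tauIntVarHat_tendstoInMeasure_of_nHit (hπ : Kernel.Invariant κ π) (hε : ε ≠ 0)
    (hmin : ∀ z, ε • ν ≤ nHit κ m z) (hm : 0 < m)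
    {f : S → ℝ} (hf : Measurable f) {C : ℝ} (hC : ∀ z, |f z| ≤ C)
    (hσ : autocov κ π (fun z => f z - ∫ z', f z' ∂π) 0 ≠ 0)
    {K : ℕ → ℕ} (hK : Tendsto K atTop atTop) (hK3 : Tendsto (fun N => (K N : ℝ) ^ 3 / N) atTop (𝓝 0))
    (μ₀ : Measure S) [IsProbabilityMeasure μ₀] :
    TendstoInMeasure (Kernel.trajMeasure (X := fun _ : ℕ => S) μ₀
        (fun n : ℕ => κ.comap (fun hh : (i : ↥(Finset.Iic n)) → S => hh ⟨n, Finset.mem_Iic.2 le_rfl⟩)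
          (measurable_pi_apply _)))
      (fun (N : ℕ) (x : ℕ → S) => ∑ s : Fin (W + 1), ∑ t : Fin (W + 1),
        tauHatGrad W (toLp 2 fun u : Fin (W + 1) =>
            acovHat (fun (i : ℕ) (x : ℕ → S) => f (x i) - ∫ z', f z' ∂π) N u x) s
          * tauHatGrad W (toLp 2 fun u : Fin (W + 1) =>
            acovHat (fun (i : ℕ) (x : ℕ → S) => f (x i) - ∫ z', f z' ∂π) N u x) t
          * gammaCross (fun i => (f (x i) - ∫ z', f z' ∂π) * (f (x (i + s)) - ∫ z', f z' ∂π))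
              (fun i => (f (x i) - ∫ z', f z' ∂π) * (f (x (i + t)) - ∫ z', f z' ∂π)) N (K N))
      atTop (fun _ => ∑ s : Fin (W + 1), ∑ t : Fin (W + 1),
        tauHatGrad W (toLp 2 fun u : Fin (W + 1) => autocov κ π (fun z => f z - ∫ z', f z' ∂π) u) s
          * tauHatGrad W (toLp 2 fun u : Fin (W + 1) => autocov κ π (fun z => f z - ∫ z', f z' ∂π) u) t
          * chainLagACov κ π (fun z => f z - ∫ z', f z' ∂π) W s t) := by
  have hgrad := fun i : Fin (W + 1) =>
    chain_tauHatGrad_tendstoInMeasure_of_nHit κ W hπ hε hmin hf hC hσ μ₀ i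
  have hcross := fun s t : Fin (W + 1) =>
    chain_gammaCross_tendstoInMeasure_of_nHit κ W hπ hε hmin hm hf hC hK hK3 μ₀ s t
  exact tendstoInMeasure_finset_sum_lim _ fun s _ => tendstoInMeasure_finset_sum_lim _ fun t _ =>
    tendstoInMeasure_mul_lim (tendstoInMeasure_mul_lim (hgrad s) (hgrad t)) (hcross s t)

end Chain

end Summit.Ventures.LatticeQCDFlow.Scoring

end
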